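import Summits.ABC.IUTFork.Repair.CandMochizuki5
import Summits.ABC.IUTFork.Repair.CandMochizuki3
import Summits.ABC.IUTFork.Cor312UnitPositive
import HarnessLib

/-!
# IUT REPAIR branch (rung LADDER-ABC:A2.RP), sub-cell B1 «Mochizuki's replies», rows RP-M01a/b/c, RP-M02a/b, RP-M45 — PROFILE v0.4 CELLS, II:
# the unit beds U (`uSetting`, `uLinkId`); the beds P♮ / P♮⁺ / COSET are the sibling file `CandMochizuki1Beds` (split only for the 400-line
# rule; the table below lists all five beds; the two files import nothing from each other so that they land independently)

PROOF-ONLY record file (D-0012; no definition, no `Prop` fact) of the abc-iut cell, IUT REPAIR branch (seat abc-iut-rp-m1, gen 2; REPAIR-SPEC v0.4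
§3 T-b PROFILE v0.4 RULE, RULINGS #11: «every candidate whose H mentions ⟨Ind1∪Ind2⟩ … or distinct hol. strs. gets a T-b cell on P♮ and U BEFORE
its word; every level-H/S row gets a P♮ cell»; pattern of abc-iut-rp-j1's `Repair/CandJoshi1Beds`, p432070). TAKES NO SIDE on [IUTchIII] Cor. 3.12
and on no author (Mochizuki / Scholze–Stix); candidates are HYPOTHESES (`def … : Prop`, never asserted); typed ≠ proved; instantiated ≠ endorsed.
Candidates (abc-iut-rp-m1 gen 0, all landed): M01a `CandMochizuki1.H` ((LVEx) chain: `(∀ m, thetaPilotOwnVol m < −|log q|) ∧ Statement`), M01b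
`CandMochizuki1.H'` ((ΘInd) = `¬ PilotKummerCompat`), M01c `CandMochizuki1.H''` ((C11)–(C14): `thetaPilotOwnVol m = avg(j²)·(−|log q|)`) — p428329;
M02a `CandMochizuki3.H` ((C17) common container), M02b `CandMochizuki3.H'` (`¬ SingleHolStr`, «distinct hol. strs.») — p428476; M45 `CandMochizuki5.H`
((MlLV) strict total hull inflation) — p429432. Beds (cited BY NAME, not restated): **P♮** = abc-iut-w5-d230's NATURAL model
(`Cor312PilotKummerNatural*`: `natFull`/`natSetting`, operator `segRegion`, datum `qDatumNat = flipFamily·Ψ`; S HOLDS through a genuine sign move,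
Statement strict, `PilotKummerCompat` holds) and **P♮⁺** = abc-iut-rp-d2's honest-action twin (`Cor312PilotKummerNaturalAct`: `actFull`/`actSetting`,
same regions and volumes); **U** = abc-iut-w4-d101's UNIT shells (`Cor312UnitCountermodel`/`Cor312UnitPositive`: Ism = the `p`-adic units, lines
pairwise distinct; `uSetting` = the unit countermodel (¬S, ¬Statement), `uLinkId` = its link-identified twin (S, Statement attained); operator
`orbitRegion`, data `qDatum` / `(uLine p 0).Ψ`); **COSET** = abc-iut-w4-d101's coset model (`Cor312UnitCosetCountermodel`: `cFull`/`cSetting`,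
operator `cosetRegion`, datum `idealDatum`; Θ-images are the PAIRS `±q^{j²}(1+p𝒪)`, ⟨Ind1∪Ind2⟩ MOVES them, the hull `B_{j²}` INFLATES strictly,
¬S, ¬Statement).

CELLS (kernel, standard axioms; one theorem per (row, bed), packaged per bed with the bed's interface clauses):
| bed | own vol. `thetaPilotOwnVol` | `−|log q|` | `−|log Θ|` | M01a | M01b | M01c | M02a | M02b | M45 |
|---|---|---|---|---|---|---|---|---|---|
| P♮ `natSetting` (S ✓, Stmt ✓ strict) | `−2` | `−2` | `−1` | ✗ (LEFT clause: own = q-vol.) | ✗ (`PilotKummerCompat` holds: the flip) | ✗ (`−2 ≠ −5`) | ✓ | ✓ (`¬SingleHolStr`: ratio 1, not j²) | ✓ (inflation `1`) |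
| P♮⁺ `actSetting` (S ✓, Stmt ✓ strict) | `−2` | `−2` | `−1` | ✗ | ✗ | ✗ | ✓ | ✓ | ✓ |
| U `uSetting` (S ✗, Stmt ✗) | `−(5/2)·log p` | `−log p` | `−(5/2)·log p` | ✗ (Statement conjunct; left ✓) | ✓ (units preserve `v_p`) | ✓ | ✓ | ✗ (honest j²) | ✗ (inflation `0`) |
| U `uLinkId` (S ✓, Stmt ✓ attained) | `−(5/2)·log p` | `−(5/2)·log p` | `−(5/2)·log p` | ✗ (left clause) | ✗ (identified datum) | ✗ | ✓ | ✓ | ✗ |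
| COSET `cSetting` (S ✗, Stmt ✗) | `−(7/2)·log p` | `−log p` | `−(5/2)·log p` | ✗ (Statement conjunct; left ✓) | ✓ | ✗ (`−7/2 ≠ −5/2`) | ✓ | ✓ (pair vol. `−(j²+1)·log p`) | ✓ (inflation `log p`, ¬Statement) |
(COSET's log-volume of a pair is the bed's one-coset normalisation `−(v_p(c)+1)·log p`, `UnitCoset.vol'`.)

READING (neutral, interface/toy level; no judgement on print): (1) M01b (ΘInd) = `¬PilotKummerCompat` by definition, so on every bed it is the
negation of the datum clause: it HOLDS at `uSetting` and COSET — beds whose (Ind2) ⊋ {±1} genuinely moves Kummer data (units) resp. Θ-REGIONS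
(cosets) and yet contains no element carrying a Θ-datum onto the q-datum (units preserve valuations) — and FAILS at P♮/P♮⁺ (the sign flip carries
`Ψ` onto `qDatumNat`) and at `uLinkId` (identified datum), as it fails at P♭ and SCAL (gen 0: `not_H'_at_linkId`, `not_H'_at_scal`). With gen 0's
cells: (ΘInd) typed holds exactly on the beds where no indeterminacy changes the VALUATION of the theta values to that of `q` and the q-datum is
not an indeterminacy-translate by construction. (2) M45 (MlLV) HOLDS at COSET together with ¬S and ¬Statement: a second NOT-A-SUPPLIER witness
(after gen 0's `midSetting`), now on a bed whose strict inflation is (Ind2)-BORNE (unit translates of the pair fill the ball `B_{j²}`) rather than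
frame-borne — inflation `−|log Θ| − own = log p`, short of the `(5/2)·log p` the Statement would need over the own volume there (`coset_inflation`).
(3) M01a's LEFT clause («λ > μlog(R)») FAILS at P♮/P♮⁺/`uLinkId` — the three beds of this file where S holds — and HOLDS at `uSetting`/COSET where
S fails: on these beds too the (LVEx) strict clause sides against the residual (gen 0 `not_S_of_H_left` is the ∀-form under honest volumes).
(4) M01c (C14) holds only at `uSetting` here (honest balls); M02a (container) holds on all five; M02b (¬SingleHolStr) fails exactly at `uSetting`.
[claim: Mochizuki2019Report, status: disputed] [claim: Mochizuki2018CommentsSS, status: disputed] [cite: ScholzeStix2018, §2.2 pp. 9–10]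
-/

noncomputable section

open Set

namespace Summit.ABC.IUTFork.Repair.CandMochizuki1BedsU

open Thm311 Cor312 Cor312.Checks Cor312.IdentifiedNonVacuity Cor312Vol Literature.IUT.LogThetaLattice
open Summit.ABC.IUTFork.Repair.CandMochizuki1 (thetaPilotOwnVol avgJsq avgJsq_toy processionNormalized_const_mul
  processionNormalized_const_add)

/-! ## 0. One general rewriting (private copy of `CandMochizuki1Beds.singleHolStr_iff_thetaRegion`, so that the two files land independently) -/

section General

variable {T : ThetaIndex} (S : LatticeSituation T) (P : Cor312.Setting S.toSituation)
  (ρ : (∀ v : T.V, v ∈ T.Vbad → Set (S.L.StarPacket v)) → ∀ (j : T.Label) (vQ : T.VQ), Set (S.L.Packet j vQ))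
  (qK : ∀ v : T.V, v ∈ T.Vbad → Set (S.L.StarPacket v))

/-- Under Thm. 3.11 (ii)(b) for the column and the two region pins, M02b's negand `SingleHolStr` («honest j²-relation between the two pilots'
pinned regions») reads: `logvol(thetaRegion 0 at j) = j² · qLocal j` at every label `j ∈ 𝔽_l^⋇` (bookkeeping: (pΘ) turns `ρ Ψ_n` into the Θ-pilot's
column-`0` Kummer image, (pq′) turns `ρ qK` into the q-pilot region). [folklore] -/
private theorem singleHolStr_iff_thetaRegion (hKumB : (S.col P.n).KummerB (S.D P.n)) (hpin : PinnedRegions S P ρ qK) :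
    CandMochizuki3.SingleHolStr S P ρ qK ↔ ∀ (i : Fin T.lstar) (vQ : T.VQ),
      (S.D P.n).logvol _ vQ (P.thetaRegion 0 (Setting.labelSucc i) vQ) =
        (((i : ℕ) + 1 : ℕ) : ℝ) ^ 2 * P.qLocal (Setting.labelSucc i) vQ := by
  have hΨ : (S.col P.n).frobΨ 0 = (S.D P.n).Ψ := funext fun v => funext fun hv => hKumB 0 v hv
  rw [CandMochizuki3.singleHolStr_iff_scaled S P ρ qK hpin.2]
  refine forall₂_congr fun i vQ => ?_
  rw [hpin.1.2 0 _ vQ, hΨ]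

end General

/-! ## 2. Bed U — the unit shells: the unit countermodel `uSetting` and its link-identified twin `uLinkId` -/

section Units

open Cor312Vol.UnitWitness Cor312Vol.NaiveWitness Cor312Vol.PinnedWitness

variable (p : ℕ) [hp : Fact p.Prime]

/-- The column-`0` Θ-image at `j` is `B_{j²}`, of log-volume `−j²·log p` (both settings share the Θ-side). [folklore] -/
theorem u_thetaRegion_logvol (m : ℤ) (i : Fin toyIndex.lstar) (vQ : toyIndex.VQ) :
    ((uFull p).toLatticeSituation.D (uSetting p).n).logvol _ vQ ((uSetting p).thetaRegion m (Setting.labelSucc i) vQ) =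
      -Real.log p * (((i : ℕ) + 1 : ℕ) : ℝ) ^ 2 := by
  rw [uSetting_thetaRegion]
  show (uLine p 0).logvol _ _ (uBall p _ _ _) = _
  rw [uLine_logvol_uBall]
  unfold jsq Setting.labelSucc
  rw [Fin.val_succ]
  push_cast
  ring

/-- **U: the Θ-pilot's own volume is `−(5/2)·log p`** (at `uSetting` and, with the same Θ-side, at `uLinkId`). [folklore] -/
theorem u_thetaPilotOwnVol (m : ℤ) : thetaPilotOwnVol (uFull p).toLatticeSituation (uSetting p) m = -(5 / 2) * Real.log p := by
  unfold CandMochizuki1.thetaPilotOwnVol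
  have hfun : (fun i : Fin toyIndex.lstar => ∑ᶠ vQ : toyIndex.VQ,
      ((uFull p).toLatticeSituation.D (uSetting p).n).logvol _ vQ ((uSetting p).thetaRegion m (Setting.labelSucc i) vQ)) =
      fun i : Fin toyIndex.lstar => -Real.log p * (((i : ℕ) + 1 : ℕ) : ℝ) ^ 2 := by
    funext i
    rw [finsum_unique]
    exact u_thetaRegion_logvol p m i _
  rw [hfun, processionNormalized_const_mul]
  show -Real.log p * avgJsq toyIndex = _
  rw [avgJsq_toy]; ring

/-- The same number at `uLinkId` (its Θ-side is `uSetting`'s). [folklore] -/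
theorem uLinkId_thetaPilotOwnVol (m : ℤ) : thetaPilotOwnVol (uFull p).toLatticeSituation (uLinkId p) m = -(5 / 2) * Real.log p := by
  unfold CandMochizuki1.thetaPilotOwnVol
  have hfun : (fun i : Fin toyIndex.lstar => ∑ᶠ vQ : toyIndex.VQ,
      ((uFull p).toLatticeSituation.D (uLinkId p).n).logvol _ vQ ((uLinkId p).thetaRegion m (Setting.labelSucc i) vQ)) =
      fun i : Fin toyIndex.lstar => -Real.log p * (((i : ℕ) + 1 : ℕ) : ℝ) ^ 2 := by
    funext i
    rw [finsum_unique, uWithQDatum_thetaRegion]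
    show (uLine p 0).logvol _ _ (uBall p _ _ _) = _
    rw [uLine_logvol_uBall]
    unfold jsq Setting.labelSucc
    rw [Fin.val_succ]
    push_cast
    ring
  rw [hfun, processionNormalized_const_mul]
  show -Real.log p * avgJsq toyIndex = _
  rw [avgJsq_toy]; ring

/-- **U `uSetting`, RP-M01a: `H` FAILS** (through the Statement conjunct; its left clause HOLDS: `−(5/2)·log p < −log p`). [folklore] -/
theorem u_not_M01a : ¬ CandMochizuki1.H (uFull p).toLatticeSituation (uSetting p) (orbitRegion p) (qDatum p) := fun h =>
  uSetting_not_statement p h.2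

/-- … the left clause at `uSetting`, for the record. [folklore] -/
theorem u_M01a_left (m : ℤ) : thetaPilotOwnVol (uFull p).toLatticeSituation (uSetting p) m < (uSetting p).negLogQ := by
  rw [u_thetaPilotOwnVol, uSetting_negLogQ]
  have := log_p_pos p
  linarith

/-- **U `uSetting`, RP-M01b: `H'` = (ΘInd) HOLDS** — no UNIT indeterminacy carries a Θ-Kummer image onto the q-datum (units preserve `v_p`;
abc-iut-w4-d101 `uSetting_not_pilotKummerCompat`), although (Ind2) ⊋ {±1} here. [folklore] -/
theorem u_M01b : CandMochizuki1.H' (uFull p).toLatticeSituation (uSetting p) (orbitRegion p) (qDatum p) :=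
  uSetting_not_pilotKummerCompat p

/-- **U `uSetting`, RP-M01c: `H''` = (C14) HOLDS** (honest balls: `−(5/2)·log p = (5/2)·(−log p)`). [folklore] -/
theorem u_M01c : CandMochizuki1.H'' (uFull p).toLatticeSituation (uSetting p) (orbitRegion p) (qDatum p) := fun m => by
  rw [u_thetaPilotOwnVol, avgJsq_toy, uSetting_negLogQ]; ring

/-- **U `uSetting`, RP-M02a: `H` HOLDS** (balls admissible; Thm. 3.11 (ii)(a) on the unit axis). [folklore] -/
theorem u_M02a : CandMochizuki3.H (uFull p).toLatticeSituation (uSetting p) (orbitRegion p) (qDatum p) :=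
  (CandMochizuki3.H_iff _ _ _ _).2
    ⟨fun m _ vQ => (uLine_adm_iff p 0 _ vQ _).2 ⟨_, uSetting_thetaRegion p m _ vQ⟩, (u_partII p 0).1⟩

/-- **U `uSetting`, RP-M02b: `H'` = ¬SingleHolStr FAILS** — the unit countermodel IS a «single hol. str.» in the typed sense (`vol B_{j²} = j²·vol B_1`).
[folklore] -/
theorem u_not_M02b : ¬ CandMochizuki3.H' (uFull p).toLatticeSituation (uSetting p) (orbitRegion p) (qDatum p) := fun h =>
  h ((singleHolStr_iff_thetaRegion _ _ _ _ (uColumn_kummerB p 0) (uSetting_pinnedRegions p)).2 fun i vQ => by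
    rw [u_thetaRegion_logvol, uSetting_qLocal]; ring)

/-- **U `uSetting`, RP-M45: `H` = (MlLV) FAILS** (no inflation: `−|log Θ| = −(5/2)·log p =` own volume). [folklore] -/
theorem u_not_M45 : ¬ CandMochizuki5.H (uFull p).toLatticeSituation (uSetting p) (orbitRegion p) (qDatum p) := by
  rintro ⟨-, h⟩
  have h0 := h 0
  rw [u_thetaPilotOwnVol, uSetting_negLogTheta, WithTop.coe_lt_coe] at h0
  exact lt_irrefl _ h0

/-- **U `uSetting` cells, packaged** (typed Thm. 3.11, bridge hypotheses, `|log(q)| > 0`, three pins HOLD; S and the Statement FAIL). [folklore] -/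
theorem uSetting_cells :
    (uFull p).Statement ∧ BridgeHyps (uSetting p) ∧ (uSetting p).AbsLogQPos ∧
      PinnedRegions3 (uFull p).toLatticeSituation (uSetting p) (orbitRegion p) (qDatum p) ∧
      ¬ PilotKummerIndRelated (uFull p).toLatticeSituation (uSetting p) (orbitRegion p) (qDatum p) ∧ ¬ (uSetting p).Statement ∧
      ¬ CandMochizuki1.H (uFull p).toLatticeSituation (uSetting p) (orbitRegion p) (qDatum p) ∧
      CandMochizuki1.H' (uFull p).toLatticeSituation (uSetting p) (orbitRegion p) (qDatum p) ∧
      CandMochizuki1.H'' (uFull p).toLatticeSituation (uSetting p) (orbitRegion p) (qDatum p) ∧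
      CandMochizuki3.H (uFull p).toLatticeSituation (uSetting p) (orbitRegion p) (qDatum p) ∧
      ¬ CandMochizuki3.H' (uFull p).toLatticeSituation (uSetting p) (orbitRegion p) (qDatum p) ∧
      ¬ CandMochizuki5.H (uFull p).toLatticeSituation (uSetting p) (orbitRegion p) (qDatum p) :=
  ⟨uFull_statement p, uSetting_bridgeHyps p, uSetting_absLogQPos p, uSetting_pinnedRegions3 p, uSetting_not_pilotKummerIndRelated p,
    uSetting_not_statement p, u_not_M01a p, u_M01b p, u_M01c p, u_M02a p, u_not_M02b p, u_not_M45 p⟩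

/-- **U `uLinkId`, RP-M01a: `H` FAILS** — through its LEFT clause (own volume `= −|log q| = −(5/2)·log p`), the Statement conjunct holding. [folklore] -/
theorem uLinkId_not_M01a : ¬ CandMochizuki1.H (uFull p).toLatticeSituation (uLinkId p) (orbitRegion p) (uLine p 0).Ψ := fun h => by
  have h0 := h.1 0
  rw [uLinkId_thetaPilotOwnVol, uLinkId_negLogQ] at h0
  exact lt_irrefl _ h0

/-- **U `uLinkId`, RP-M01b: `H'` FAILS** (`PilotKummerCompat` holds for the identified datum). [folklore] -/
theorem uLinkId_not_M01b : ¬ CandMochizuki1.H' (uFull p).toLatticeSituation (uLinkId p) (orbitRegion p) (uLine p 0).Ψ := fun h =>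
  h (uLinkId_pilotKummerCompat p)

/-- **U `uLinkId`, RP-M01c: `H''` FAILS** (`−(5/2)·log p ≠ (5/2)·(−(5/2)·log p)`). [folklore] -/
theorem uLinkId_not_M01c : ¬ CandMochizuki1.H'' (uFull p).toLatticeSituation (uLinkId p) (orbitRegion p) (uLine p 0).Ψ := fun h => by
  have h0 := h 0
  rw [uLinkId_thetaPilotOwnVol, avgJsq_toy, uLinkId_negLogQ] at h0
  have := log_p_pos p
  nlinarith

/-- **U `uLinkId`, RP-M02a: `H` HOLDS.** [folklore] -/
theorem uLinkId_M02a : CandMochizuki3.H (uFull p).toLatticeSituation (uLinkId p) (orbitRegion p) (uLine p 0).Ψ :=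
  (CandMochizuki3.H_iff _ _ _ _).2
    ⟨fun m _ vQ => (uLine_adm_iff p 0 _ vQ _).2 ⟨_, uWithQDatum_thetaRegion p _ _ m _ vQ⟩, (u_partII p 0).1⟩

/-- **U `uLinkId`, RP-M02b: `H'` = ¬SingleHolStr HOLDS** (label `2`: both regions are `B_4`, `−4·log p ≠ 4·(−4·log p)`). [folklore] -/
theorem uLinkId_M02b : CandMochizuki3.H' (uFull p).toLatticeSituation (uLinkId p) (orbitRegion p) (uLine p 0).Ψ := fun h => by
  have h1 := (singleHolStr_iff_thetaRegion _ _ _ _ (uColumn_kummerB p 0) (uWithQDatum_pinnedRegions3 p _ _).1).1 h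
    ⟨1, lt_of_lt_of_le (by norm_num) toyIndex.two_le_lstar⟩ ()
  have hv : ((uFull p).toLatticeSituation.D (uLinkId p).n).logvol _ ()
      ((uLinkId p).thetaRegion 0 (Setting.labelSucc ⟨1, lt_of_lt_of_le (by norm_num) toyIndex.two_le_lstar⟩) ()) =
      -Real.log p * (((1 : ℕ) + 1 : ℕ) : ℝ) ^ 2 := by
    rw [uWithQDatum_thetaRegion]
    show (uLine p 0).logvol _ _ (uBall p _ _ _) = _
    rw [uLine_logvol_uBall]
    unfold jsq Setting.labelSucc
    rw [Fin.val_succ]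
    push_cast
    ring
  rw [hv, uLinkId_qLocal] at h1
  unfold jsq Setting.labelSucc at h1
  rw [Fin.val_succ] at h1
  push_cast at h1
  have := log_p_pos p
  nlinarith

/-- **U `uLinkId`, RP-M45: `H` FAILS** (`−|log Θ| = −(5/2)·log p =` own volume). [folklore] -/
theorem uLinkId_not_M45 : ¬ CandMochizuki5.H (uFull p).toLatticeSituation (uLinkId p) (orbitRegion p) (uLine p 0).Ψ := by
  rintro ⟨-, h⟩
  have h0 := h 0
  rw [uLinkId_thetaPilotOwnVol, uWithQDatum_negLogTheta, WithTop.coe_lt_coe] at h0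
  exact lt_irrefl _ h0

/-- **U `uLinkId` cells, packaged** (typed Thm. 3.11, bridge hypotheses, `|log(q)| > 0`, three pins, S and the Statement HOLD). [folklore] -/
theorem uLinkId_cells :
    (uFull p).Statement ∧ BridgeHyps (uLinkId p) ∧ (uLinkId p).AbsLogQPos ∧
      PinnedRegions3 (uFull p).toLatticeSituation (uLinkId p) (orbitRegion p) (uLine p 0).Ψ ∧
      PilotKummerIndRelated (uFull p).toLatticeSituation (uLinkId p) (orbitRegion p) (uLine p 0).Ψ ∧ (uLinkId p).Statement ∧
      ¬ CandMochizuki1.H (uFull p).toLatticeSituation (uLinkId p) (orbitRegion p) (uLine p 0).Ψ ∧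
      ¬ CandMochizuki1.H' (uFull p).toLatticeSituation (uLinkId p) (orbitRegion p) (uLine p 0).Ψ ∧
      ¬ CandMochizuki1.H'' (uFull p).toLatticeSituation (uLinkId p) (orbitRegion p) (uLine p 0).Ψ ∧
      CandMochizuki3.H (uFull p).toLatticeSituation (uLinkId p) (orbitRegion p) (uLine p 0).Ψ ∧
      CandMochizuki3.H' (uFull p).toLatticeSituation (uLinkId p) (orbitRegion p) (uLine p 0).Ψ ∧
      ¬ CandMochizuki5.H (uFull p).toLatticeSituation (uLinkId p) (orbitRegion p) (uLine p 0).Ψ :=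
  ⟨uFull_statement p, uWithQDatum_bridgeHyps p _ _, uLinkId_absLogQPos p, uWithQDatum_pinnedRegions3 p _ _,
    uLinkId_pilotKummerIndRelated p, uLinkId_statement p, uLinkId_not_M01a p, uLinkId_not_M01b p, uLinkId_not_M01c p, uLinkId_M02a p,
    uLinkId_M02b p, uLinkId_not_M45 p⟩

end Units
end Summit.ABC.IUTFork.Repair.CandMochizuki1BedsU

end
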